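/-
Literature/Geometry/Lorentzian/SubdatumEmbeddingLift.lean — relocation to `Literature/` of four PROVED transport lemmas that lived Summits-side
(`Summits/FinalStateConjecture/…/Theorems/SwallowTheDatumSubdataDevelopmentsEmbedRigidity.lean`: `SubdataDevelopmentsEmbed.mfderiv_comp_embed_apply_rel`,
`SubdataDevelopmentsEmbed.mfderiv_normal_rel`; `…/Theorems/PhaseMixingCaptureWeakCosmicCensorshipMGHDStubScriTransfer.lean`:
`exists_isMaximalGeodesicOn_lift`, `exists_isNormalisedNullRayFrom_lift`), so that Literature files (first user: the discharge
`LedgerNaturality.lean` of the named fact `LedgerIsoInvariant`, D22) can import them (item wi-98146, D33 of decomp-fsc lens-5 g10; critic row 99).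
THEOREMS ONLY: no `def`, no named fact, no `sorry`, no instance, no notation (D-0026 net debt 0).  Statements and proofs VERBATIM from the tree
(authors: the SwallowTheDatum ∕ PhaseMixingCapture provers), namespace `Literature.Geometry.Lorentzian.SubdatumLift` (distinct fqns; the Summits
copies and their users are re-pointed ∕ deleted by their owners in a follow-up — this file touches nothing under `Summits/`).
-/
import Literature.Geometry.Lorentzian.NullInfinity
import Literature.Geometry.Lorentzian.InitialDataPullback
import Literature.Geometry.Lorentzian.ConvergenceTransport
import Literature.Geometry.Lorentzian.CauchyDevelopmentIsometryClasses
import Literature.Geometry.Riemannian.AHConvexNearInfinity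
import Literature.Geometry.Lorentzian.GeodesicMaximal
import Literature.Geometry.Lorentzian.LeviCivitaProofs
import Literature.Geometry.Lorentzian.IsometryProofs
import Literature.Geometry.Lorentzian.MGHDUniqueness
import Literature.Geometry.Lorentzian.DevelopmentImmersionInjective
import HarnessLib

/-!
# Embeddings over a sub-datum: the relative one-jet along the data hypersurface, and the lift of maximal geodesics ∕ normalised null rays

Generic Lorentzian geometry (no Kerr, no PDE), used by the Final State cone on both sides of the `Literature`/`Summits` divide:

* §1 `mfderiv_comp_embed_apply_rel` — for `ψ : M₁ → M₂` and `Φ : N → X` with `ψ ∘ ι₁ = ι₂ ∘ Φ`: `dψ (dι₁ v) = dι₂ (dΦ v)` (chain rule);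
  `mfderiv_normal_rel` — if moreover `ψ` is a time-orientation preserving isometric immersion and `dΦ` is pointwise injective, `dψ (ν₁ x) = ν₂ (Φ x)`
  (uniqueness of the future unit normal of a spacelike hyperplane, tree `TimeOrientation.eq_of_isFutureUnitNormal`).  Sbierski, AHP 17 (2016)
  §3.1, proof of Cor. 3.2, RELATIVE form (`Φ` inserted; the case `Φ = id` is the tree's `CauchyDevelopmentOneJet` ∕ `MGHDUniqueness`).
* §2 `exists_isMaximalGeodesicOn_lift` — maximal geodesics lift along equidimensional local isometries `χ : (M', χ^* g) → (M, g)` with prescribed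
  initial data, with domain contained in that of the geodesic below (O'Neill 1983, Ch. 3, Prop. 3.24 existence ∕ uniqueness of maximal geodesics,
  tree `exists_isMaximalGeodesicOn`; `χ ∘ γ'` is a geodesic, tree `SimpleAH.isGeodesicOn_comp`, O'Neill pp. 90–91).
* §3 `exists_isNormalisedNullRayFrom_lift` — for data embeddings `𝒮 → 𝒟` over `Φ` (`𝒮` a data embedding of the pulled-back datum `Φ^* D`), a
  normalised null ray of `𝒟` from `ι (Φ p)` restricts to the image of a normalised null ray of `𝒮` from `p` (null and future-directed because `dχ`
  is a time-orientation preserving linear isometry; normalised by §1).  Christodoulou, CQG 16 (1999) A23, p. A26 (normalisation of null geodesics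
  against the unit normal of the Cauchy hypersurface); Dafermos–Rodnianski, arXiv:0811.0354, §2.6.2.

HONEST REGISTER.  Nothing new is claimed: the four theorems are the tree's Summits-side theorems moved verbatim (same hypotheses, same proofs);
relocation only, so that `Literature/` users need not carry copies.  No definitions, no named facts.

## References

* [ONeill1983] B. O'Neill, *Semi-Riemannian geometry*, Academic Press (1983): Ch. 3, Prop. 24 and pp. 90–91; Ch. 5, Lemma 26, p. 145.
* [Sbierski2016AHP] J. Sbierski, *On the existence of a maximal Cauchy development for the Einstein equations: a dezornification*, Ann. Henri
  Poincaré 17 (2016) = arXiv:1309.7591, §3.1, proof of Cor. 3.2.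
* [arXiv08110354] M. Dafermos, I. Rodnianski, *Lectures on black holes and linear waves*, arXiv:0811.0354, §2.6.2.

## Provenance

Item wi-98146 (kind cite ∕ relocation; route-FinalStateConjecture-RootDecompFarLedgerCells, requested by decomp-fsc-writer-1-g3 for lens-5 g10's
`LedgerNaturality.lean`, critic row 99 «D33 LOW-MED»).  Source text: the tree files named in the header (Summits theorems, proved, axioms standard),
as copied with LITERATURE-ONLY imports in `HOME/decomp-fsc-lens-5/g10/LedgerNaturality.lean` §0 (sha16 04ed4b47e9cc93b3, l.95–240).  Filed by a
literature-prover seat (pub-hodgecm2 lit-deligne-3 g66, THE PASS); theorems only, net Literature debt 0.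
-/

noncomputable section

open scoped Manifold ContDiff Topology
open Set Function Filter Literature.Geometry.Lorentzian

namespace Literature.Geometry.Lorentzian.SubdatumLift

/-! ## §1 The one-jet of an embedding over a sub-datum along the data hypersurface -/

section RelJet

universe u v

variable {n : ℕ}
  {N : Type u} [TopologicalSpace N] [ChartedSpace (EuclideanSpace ℝ (Fin n)) N]
  [IsManifold (𝓡 n) ∞ N] [ConnectedSpace N] {D₁ : InitialDataSet (𝓡 n) N}
  {X : Type v} [TopologicalSpace X] [ChartedSpace (EuclideanSpace ℝ (Fin n)) X]
  [IsManifold (𝓡 n) ∞ X] [ConnectedSpace X] {D₂ : InitialDataSet (𝓡 n) X}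

variable (𝒮₁ : DataEmbedding D₁) (𝒮₂ : DataEmbedding D₂)

/-- **Chain rule along the data hypersurface, relative form**: if `ψ ∘ ι₁ = ι₂ ∘ Φ` for
differentiable `ψ : M₁ → M₂` and `Φ : N → X`, then `dψ (dι₁ v) = dι₂ (dΦ v)`. Sbierski 2016,
§3.1, proof of Cor. 3.2 ("their differentials agree on `Σ` if evaluated on vectors tangent to
`Σ`"), with `Φ` inserted. [cite: Sbierski2016AHP, §3.1, proof of Cor. 3.2] -/
theorem mfderiv_comp_embed_apply_rel {ψ : 𝒮₁.carrier → 𝒮₂.carrier}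
    (hψ : MDifferentiable (𝓡 (n + 1)) (𝓡 (n + 1)) ψ) {Φ : N → X}
    (hΦ : MDifferentiable (𝓡 n) (𝓡 n) Φ) (hψι : ψ ∘ 𝒮₁.embed = 𝒮₂.embed ∘ Φ) (x : N)
    (v : TangentSpace (𝓡 n) x) :
    mfderiv (𝓡 (n + 1)) (𝓡 (n + 1)) ψ (𝒮₁.embed x) (mfderiv (𝓡 n) (𝓡 (n + 1)) 𝒮₁.embed x v) =
      mfderiv (𝓡 n) (𝓡 (n + 1)) 𝒮₂.embed (Φ x) (mfderiv (𝓡 n) (𝓡 n) Φ x v) := by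
  have h₁ := mfderiv_comp x (hψ (𝒮₁.embed x)) (𝒮₁.mdifferentiable_embed x)
  have h₂ := mfderiv_comp x (𝒮₂.mdifferentiable_embed (Φ x)) (hΦ x)
  rw [hψι] at h₁
  have h := h₁.symm.trans h₂
  exact congrArg (fun L ↦ L v) h

/-- **An embedding over a sub-datum maps the future unit normal to the future unit normal**:
if `ψ : M₁ → M₂` is a time-orientation preserving isometric immersion with `ψ ∘ ι₁ = ι₂ ∘ Φ`,
where `dΦ` is pointwise injective (so bijective: `N`, `X` are equidimensional), then
`dψ (ν₁ x) = ν₂ (Φ x)`: `dψ (ν₁ x)` has square `-1`, is future-directed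
(`PreservesTimeOrientation.isFutureDirected_mfderiv`) and is normal to
`dι₂ (T_{Φ x} X) = dι₂ (dΦ (T_x N)) = dψ (dι₁ (T_x N))`, and the future unit normal of a
spacelike hyperplane is unique (`TimeOrientation.eq_of_isFutureUnitNormal`). Sbierski 2016,
§3.1, proof of Cor. 3.2 ("they both map the future normal of `Σ` onto the future normal"),
relative form. [cite: Sbierski2016AHP, §3.1, proof of Cor. 3.2] [cite: ONeill1983, Ch. 5, Lemma 26] -/
theorem mfderiv_normal_rel {ψ : 𝒮₁.carrier → 𝒮₂.carrier}
    (hψi : 𝒮₁.metric.IsIsometricImmersion 𝒮₂.metric.toPseudoRiemannianMetric ψ)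
    (hψτ : 𝒮₁.timeOrientation.PreservesTimeOrientation ψ 𝒮₂.timeOrientation) {Φ : N → X}
    (hΦ : MDifferentiable (𝓡 n) (𝓡 n) Φ) (hΦ' : ∀ x, Injective (mfderiv (𝓡 n) (𝓡 n) Φ x))
    (hψι : ψ ∘ 𝒮₁.embed = 𝒮₂.embed ∘ Φ) (x : N) :
    mfderiv (𝓡 (n + 1)) (𝓡 (n + 1)) ψ (𝒮₁.embed x) (𝒮₁.normal x) = 𝒮₂.normal (Φ x) := by
  have hψd : MDifferentiable (𝓡 (n + 1)) (𝓡 (n + 1)) ψ := hψi.1.mdifferentiable (by simp)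
  have hx : ψ (𝒮₁.embed x) = 𝒮₂.embed (Φ x) := congrFun hψι x
  have key : ∀ u w : TangentSpace (𝓡 (n + 1)) (𝒮₁.embed x),
      𝒮₂.metric.val (ψ (𝒮₁.embed x)) (mfderiv (𝓡 (n + 1)) (𝓡 (n + 1)) ψ (𝒮₁.embed x) u)
        (mfderiv (𝓡 (n + 1)) (𝓡 (n + 1)) ψ (𝒮₁.embed x) w) =
      𝒮₁.metric.val (𝒮₁.embed x) u w := fun u w ↦ by
    have h := congrArg (fun b ↦ b u w) (hψi.2 (𝒮₁.embed x))
    simpa only [pullbackBilin_apply] using h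
  have hsurj : Surjective (mfderiv (𝓡 n) (𝓡 n) Φ x) :=
    (mfderiv_bijective_of_injective (I := 𝓡 n) (I' := 𝓡 n) (hΦ' x) rfl).2
  refine 𝒮₂.timeOrientation.eq_of_isFutureUnitNormal hx.symm
    (mfderiv (𝓡 n) (𝓡 (n + 1)) 𝒮₂.embed (Φ x))
    (fun v hv ↦ 𝒮₂.val_mfderiv_embed_pos (Φ x) hv)
    (DataEmbedding.finrank_tangentSpace_add_one (Φ x))
    (𝒮₂.isFutureUnitNormal.1.1 (Φ x)) (𝒮₂.isFutureUnitNormal.1.2 (Φ x))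
    (𝒮₂.isFutureUnitNormal.2 (Φ x)) (fun v ↦ ?_) ?_ ?_
  · obtain ⟨v', rfl⟩ := hsurj v
    rw [← mfderiv_comp_embed_apply_rel 𝒮₁ 𝒮₂ hψd hΦ hψι x v', key]
    exact 𝒮₁.isFutureUnitNormal.1.1 x v'
  · rw [key]
    exact 𝒮₁.isFutureUnitNormal.1.2 x
  · exact hψτ.isFutureDirected_mfderiv hψi.2 (𝒮₁.isFutureUnitNormal.2 x)

end RelJet

/-! ## §2 Maximal geodesics lift along local isometries -/

section Lift

variable {E : Type*} [NormedAddCommGroup E] [NormedSpace ℝ E] {H : Type*} [TopologicalSpace H]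
  {I : ModelWithCorners ℝ E H} {M : Type*} [TopologicalSpace M] [ChartedSpace H M]
  [IsManifold I ∞ M]
  {E' : Type*} [NormedAddCommGroup E'] [NormedSpace ℝ E'] {H' : Type*} [TopologicalSpace H']
  {I' : ModelWithCorners ℝ E' H'} {M' : Type*} [TopologicalSpace M'] [ChartedSpace H' M']
  [IsManifold I' ∞ M']
  [FiniteDimensional ℝ E] [FiniteDimensional ℝ E'] [CompleteSpace E] [CompleteSpace E']
  [T2Space M] [T2Space M'] [I.Boundaryless] [I'.Boundaryless]

/-- **Maximal geodesics lift along local isometries, with prescribed initial data.**  Let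
`χ : M' → M` be a smooth immersion between manifolds of the same dimension with `χ^* g = g'`
(smooth metrics, Hausdorff manifolds without boundary), `γ` a maximal `g`-geodesic on `dom ∋ 0`,
and `(q, w) ∈ TM'` initial data over those of `γ`: `χ q = γ 0`, `dχ_q w = γ' 0`.  Then the
maximal `g'`-geodesic `γ'` with `γ' 0 = q`, `γ'' 0 = w` has domain `dom' ⊆ dom` and
`χ (γ' t) = γ t` for `t ∈ dom'`.  Indeed `g'` is the pulled-back metric `χ^* g`
(`PseudoRiemannianMetric.comap`, by extensionality), so `χ ∘ γ'` is a `g`-geodesic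
(`SimpleAH.isGeodesicOn_comp`) with the initial data of `γ`; the maximal `g`-geodesic with these
data restricts to `γ` on `dom` and, `γ` being maximal, has domain exactly `dom`, and it restricts
to `χ ∘ γ'` on `dom'`.  O'Neill 1983, Ch. 3, Prop. 3.24 and pp. 90–91. [cite: ONeill1983, Ch. 3, Prop. 24 and pp. 90–91] -/
theorem exists_isMaximalGeodesicOn_lift
    {g : PseudoRiemannianMetric I ∞ E (TangentSpace I : M → Type _)} [g.HasLeviCivita]
    {g' : PseudoRiemannianMetric I' ∞ E' (TangentSpace I' : M' → Type _)} [g'.HasLeviCivita]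
    {χ : M' → M} (hχ : ContMDiff I' I (∞ + 1) χ) (hχ' : ∀ y, Injective (mfderiv I' I χ y))
    (hdim : Module.finrank ℝ E' = Module.finrank ℝ E)
    (hiso : ∀ y, pullbackBilin (I := I) (I' := I') χ g.val y = g'.val y)
    {γ : ℝ → M} {dom : Set ℝ} (hmax : IsMaximalGeodesicOn g.leviCivita γ dom) (h0 : (0 : ℝ) ∈ dom)
    {q : M'} (hq : χ q = γ 0) {w : TangentSpace I' q}
    (hw : mfderiv I' I χ q w = velocity I γ 0) :
    ∃ (γ' : ℝ → M') (dom' : Set ℝ), IsMaximalGeodesicOn g'.leviCivita γ' dom' ∧ (0 : ℝ) ∈ dom' ∧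
      γ' 0 = q ∧ velocity I' γ' 0 = w ∧ dom' ⊆ dom ∧ ∀ t ∈ dom', χ (γ' t) = γ t := by
  have hpb := PseudoRiemannianMetric.contMDiff_pullbackBilin_holds (I := I) (M := M) (I' := I')
    (N := M') (n := (∞ : ℕ∞ω))
  -- `g'` is the pulled-back metric `χ^* g`
  have hgc : g' = g.comap hpb χ hχ hχ' hdim :=
    PseudoRiemannianMetric.ext (funext fun y ↦ (hiso y).symm)
  subst hgc
  -- the Levi-Civita connections are `C¹`
  have h2 : ((1 : ℕ∞) : ℕ∞ω) + 1 ≤ ∞ := by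
    rw [show ((1 : ℕ∞) : ℕ∞ω) + 1 = 2 by norm_num]; exact WithTop.coe_le_coe.2 le_top
  haveI : CovariantDerivative.ContMDiffCovariantDerivative g.leviCivita 1 :=
    ⟨g.isLocallyContMDiff_leviCivita_holds 1 h2 univ isOpen_univ⟩
  haveI : CovariantDerivative.ContMDiffCovariantDerivative
      (g.comap hpb χ hχ hχ' hdim).leviCivita 1 :=
    ⟨(g.comap hpb χ hχ hχ' hdim).isLocallyContMDiff_leviCivita_holds 1 h2 univ isOpen_univ⟩
  -- the maximal `χ^* g`-geodesic with data `(q, w)`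
  obtain ⟨γ', D', hmax', h0D', hγ'0, hγ'v, -⟩ :=
    exists_isMaximalGeodesicOn (cov := (g.comap hpb χ hχ hχ' hdim).leviCivita) q w
  -- its image is a `g`-geodesic with the initial data of `γ`
  obtain ⟨hcomp, hcompv⟩ := Literature.Geometry.Riemannian.SimpleAH.isGeodesicOn_comp
    (hpb := hpb) (hf := hχ) (hf' := hχ') (hdim := hdim) hmax'.isOpen hmax'.isGeodesicOn
  have hpos0 : χ (γ' 0) = γ 0 := by rw [hγ'0, hq]
  have hvel0 : velocity I (fun t ↦ χ (γ' t)) 0 = velocity I γ 0 := by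
    rw [hcompv 0 h0D']
    have h1 : (mfderiv I' I χ (γ' 0) (velocity I' γ' 0) : E) =
        mfderiv I' I χ q (velocity I' γ' 0) :=
      Literature.Geometry.Riemannian.CartanHadamard.mfderiv_congr_point hγ'0 _
    rw [h1, hγ'v, hw]
  -- the maximal `g`-geodesic with the data of `γ` is `γ` on `dom`, and contains `χ ∘ γ'`
  obtain ⟨Γ, S, hΓmax, -, -, -, hΓr⟩ :=
    exists_isMaximalGeodesicOn (cov := g.leviCivita) (γ 0) (velocity I γ 0)
  obtain ⟨hdomS, hγΓ⟩ := hΓr γ dom hmax.isOpen hmax.2.1 h0 hmax.isGeodesicOn rfl rfl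
  have hSdom : S = dom :=
    hmax.2.2.2 Γ S hΓmax.isOpen hΓmax.2.1 hdomS hΓmax.isGeodesicOn hγΓ
  obtain ⟨hD'S, hγ'Γ⟩ := hΓr (fun t ↦ χ (γ' t)) D' hmax'.isOpen hmax'.2.1 h0D' hcomp hpos0 hvel0
  rw [hSdom] at hD'S
  exact ⟨γ', D', hmax', h0D', hγ'0, hγ'v, hD'S, fun t ht ↦ (hγ'Γ ht).trans (hγΓ (hD'S ht)).symm⟩

end Lift

/-! ## §3 Normalised null rays lift along embeddings of data embeddings over a sub-datum -/

section Data

universe u v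

variable {X : Type u} [TopologicalSpace X] [ChartedSpace E3 X] [IsManifold (𝓡 3) ∞ X]
  [ConnectedSpace X] {D : InitialDataSet (𝓡 3) X}
  {N : Type v} [TopologicalSpace N] [ChartedSpace E3 N] [IsManifold (𝓡 3) ∞ N] [ConnectedSpace N]
  {Φ : N → X} {hΦ : ContMDiff (𝓡 3) (𝓡 3) (∞ + 1) Φ}
  {hΦ' : ∀ u, Function.Injective (mfderiv (𝓡 3) (𝓡 3) Φ u)}

/-- **Normalised null rays of `𝒟` from `ι (Φ p)` lift to normalised null rays of `𝒮` from `p`.**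
Let `𝒟` be a data embedding of `D` on `X`, `𝒮` a data embedding of the pulled-back datum `Φ^* D`
on `N` (`dΦ` injective), and `χ : 𝒮 → 𝒟` a smooth, isometric, time-orientation preserving map
over `Φ` (`χ ∘ ι' = ι ∘ Φ`).  Every normalised null ray `γ : dom` of `𝒟` from `ι (Φ p)` restricts
to `χ ∘ γ'` on some `dom' ⊆ dom`, where `γ' : dom'` is a normalised null ray of `𝒮` from `p`: take
the maximal lift with data `(ι' p, dχ⁻¹ (γ' 0))` (`exists_isMaximalGeodesicOn_lift`); its velocity
is null and future-directed since `dχ` is a time-orientation preserving linear isometry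
(`PreservesTimeOrientation.isFutureDirected_of_mfderiv`), and normalised against `ν' p` because
`dχ (ν' p) = ν (Φ p)` (`mfderiv_normal_rel`).  Christodoulou, CQG 16
(1999) A23, p. A26; O'Neill 1983, Ch. 3, pp. 90–91 and Ch. 5, p. 145. [cite: ONeill1983, Ch. 3, pp. 90–91 and Ch. 5, p. 145]
[cite: arXiv08110354, §2.6.2] -/
theorem exists_isNormalisedNullRayFrom_lift (𝒟 : DataEmbedding D)
    (𝒮 : DataEmbedding (D.comap Φ hΦ hΦ')) {χ : 𝒮.carrier → 𝒟.carrier}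
    (hχ : ContMDiff (𝓡 4) (𝓡 4) ∞ χ)
    (hiso : 𝒮.metric.IsIsometricImmersion 𝒟.metric.toPseudoRiemannianMetric χ)
    (hτ : 𝒮.timeOrientation.PreservesTimeOrientation χ 𝒟.timeOrientation)
    (hcomm : χ ∘ 𝒮.embed = 𝒟.embed ∘ Φ)
    [𝒟.metric.HasLeviCivita] [𝒮.metric.HasLeviCivita]
    {p : N} {γ : ℝ → 𝒟.carrier} {dom : Set ℝ}
    (hγ : 𝒟.metric.IsNormalisedNullRayFrom 𝒟.timeOrientation 𝒟.embed 𝒟.normal (Φ p) γ dom) :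
    ∃ (γ' : ℝ → 𝒮.carrier) (dom' : Set ℝ),
      𝒮.metric.IsNormalisedNullRayFrom 𝒮.timeOrientation 𝒮.embed 𝒮.normal p γ' dom' ∧
        dom' ⊆ dom ∧ ∀ t ∈ dom', χ (γ' t) = γ t := by
  -- `dχ` preserves scalar products, hence is injective
  have hval : ∀ (y : 𝒮.carrier) (u u' : TangentSpace (𝓡 4) y), 𝒮.metric.val y u u' =
      𝒟.metric.val (χ y) (mfderiv (𝓡 4) (𝓡 4) χ y u) (mfderiv (𝓡 4) (𝓡 4) χ y u') :=
    fun y u u' ↦ by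
      have h := congrArg (fun b ↦ b u u') (hiso.2 y)
      simpa only [pullbackBilin_apply] using h.symm
  have hχ' : ∀ y, Injective (mfderiv (𝓡 4) (𝓡 4) χ y) := fun y ↦ by
    refine (injective_iff_map_eq_zero _).2 fun u hu ↦ 𝒮.metric.nondegenerate y u fun u' ↦ ?_
    rw [hval, hu, map_zero]
    rfl
  have hdim : Module.finrank ℝ E4 = Module.finrank ℝ E4 := rfl
  have hχ1 : ContMDiff (𝓡 4) (𝓡 4) (∞ + 1) χ := hχ
  have hΦd : MDifferentiable (𝓡 3) (𝓡 3) Φ := (hΦ.of_le le_self_add).mdifferentiable (by simp)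
  -- initial data of the lift
  have hx0 : χ (𝒮.embed p) = γ 0 := (congrFun hcomm p).trans hγ.apply_zero.symm
  set w : TangentSpace (𝓡 4) (𝒮.embed p) :=
    (mfderivEquivOfInjective (I := 𝓡 4) (I' := 𝓡 4) χ (𝒮.embed p) (hχ' _) hdim).symm
      (show TangentSpace (𝓡 4) (χ (𝒮.embed p)) from velocity (𝓡 4) γ 0) with hw_def
  have hLw : mfderiv (𝓡 4) (𝓡 4) χ (𝒮.embed p) w = velocity (𝓡 4) γ 0 :=
    mfderiv_mfderivEquivOfInjective_symm χ _ (hχ' _) hdim _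
  obtain ⟨γ', D', hmax', h0D', hγ'0, hγ'v, hD', hagree⟩ :=
    exists_isMaximalGeodesicOn_lift (g := 𝒟.metric.toPseudoRiemannianMetric)
      (g' := 𝒮.metric.toPseudoRiemannianMetric) hχ1 hχ' hdim hiso.2 hγ.isMaximalGeodesicOn
      hγ.zero_mem hx0 hLw
  refine ⟨γ', D', ⟨hmax', h0D', hγ'0, ?_, ?_, ?_⟩, hD', hagree⟩
  · -- null
    have key : ∀ (y : 𝒮.carrier) (_ : y = 𝒮.embed p) (u : E4) (_ : u = w),
        𝒮.metric.IsNull (show TangentSpace (𝓡 4) y from u) := by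
      rintro y rfl u rfl
      refine ⟨?_, fun hw0 ↦ hγ.isNull_velocity.2 ?_⟩
      · rw [hval, hLw]
        have key' : ∀ (x : 𝒟.carrier) (_ : x = γ 0),
            𝒟.metric.val x (show TangentSpace (𝓡 4) x from velocity (𝓡 4) γ 0)
              (show TangentSpace (𝓡 4) x from velocity (𝓡 4) γ 0) = 0 := by
          rintro x rfl
          exact hγ.isNull_velocity.1
        exact key' _ hx0
      · rw [← hLw, hw0, map_zero]
        rfl
    exact key _ hγ'0 _ hγ'v
  · -- future-directed
    have key : ∀ (y : 𝒮.carrier) (_ : y = 𝒮.embed p) (u : E4) (_ : u = w),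
        𝒮.timeOrientation.IsFutureDirected (show TangentSpace (𝓡 4) y from u) := by
      rintro y rfl u rfl
      refine hτ.isFutureDirected_of_mfderiv hiso.2 ?_
      rw [hLw]
      have key' : ∀ (x : 𝒟.carrier) (_ : x = γ 0),
          𝒟.timeOrientation.IsFutureDirected
            (show TangentSpace (𝓡 4) x from velocity (𝓡 4) γ 0) := by
        rintro x rfl
        exact hγ.isFutureDirected_velocity
      exact key' _ hx0
    exact key _ hγ'0 _ hγ'v
  · -- normalised: `dχ (ν' p) = ν (Φ p)`
    have hν := mfderiv_normal_rel 𝒮 𝒟 hiso hτ hΦd hΦ' hcomm p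
    have key : ∀ (u : E4) (_ : u = w),
        𝒮.metric.val (𝒮.embed p) (show TangentSpace (𝓡 4) (𝒮.embed p) from u) (𝒮.normal p)
          = -1 := by
      rintro u rfl
      rw [hval, hLw, hν]
      have key' : ∀ (x : 𝒟.carrier) (_ : x = 𝒟.embed (Φ p)),
          𝒟.metric.val x (show TangentSpace (𝓡 4) x from velocity (𝓡 4) γ 0)
            (show TangentSpace (𝓡 4) x from 𝒟.normal (Φ p)) = -1 := by
        rintro x rfl
        exact hγ.val_velocity_normal
      exact key' _ (congrFun hcomm p)
    exact key _ hγ'v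

end Data

end Literature.Geometry.Lorentzian.SubdatumLift

end
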